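import Literature.AlgebraicGeometry.Motives.JacobianGaloisDescent
import Literature.AlgebraicGeometry.Resolution.IdealSheafDescent
import Literature.AlgebraicGeometry.Limits.RatFnLimitDescent
import Literature.RingTheory.GaloisAlgebras.SpeiserLemma
import Literature.RingTheory.GaloisAlgebras.GaloisDescentFixedPoints
import Mathlib.AlgebraicGeometry.Morphisms.Flat
import Mathlib.Algebra.Category.Ring.Constructions
import HarnessLib

/-!
# Galois descent of quasi-coherent ideal sheaves: a `Gal(L/K)`-invariant ideal sheaf on `X_L`
# comes from `X` (Görtz–Wedhorn I, Thm. 14.83 / (14.21); Serre, *Local Fields*, X §2)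

Let `L/K` be a finite Galois extension with group `Γ = L ≃ₐ[K] L`, `X` a `K`-scheme and
`X_L = X ×_K Spec L` its base change, on which `Γ` acts through the second factor
(`GaloisDescent.gal`, `Motives/JacobianGaloisDescent`). For the affine faithfully flat projection
`pr : X_L → X`, Mathlib's push-forward `I.map pr` of an ideal sheaf `I` on `X_L` is the largest
ideal sheaf `J` on `X` with `J·𝒪_{X_L} ≤ I`, and `(I.map pr).comap pr ≤ I` always. This file proves
the descent statement every Galois-descent argument for closed subschemes / blow-up centres uses:

* `Ideal.map_comap_eq_of_forall_map_le` — ring level (Speiser): for `D ≅ L ⊗_K C`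
  (`Algebra.IsPushout K L C D`) with `Γ` acting by ring endomorphisms fixing `C` and inducing `σ` on
  `L`, an ideal `𝔞 ⊆ D` stable under the action is extended from `C`: `𝔞 = (𝔞 ∩ C)·D`. Proof: the
  `L`-submodule `𝔞` with the restricted (semilinear) action is spanned over `L` by its fixed vectors
  (`SpeiserLemma.mem_span_fixedPoints`), and fixed vectors of `D` come from `C`
  (`GaloisDescentFixedPoints.mem_range_of_isPushout_of_forall_eq`).
* `GaloisDescent.comap_map_fst_eq_of_forall_comap_gal_eq` — scheme level: **an ideal sheaf `I` on
  `X_L` with `(gal σ)⁻¹ I = I` for all `σ ∈ Γ` satisfies `(I.map pr)·𝒪_{X_L} = I`**, i.e. it is the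
  pull-back of an ideal sheaf on `X` (namely `I.map pr`). Proof: both sides are quasi-coherent, so
  it
  suffices to compare sections on the affine opens `pr⁻¹U`, `U ⊆ X` affine (Mathlib
  `IdealSheafData.ext_of_iSup_eq_top`); there `Γ(X_L, pr⁻¹U) ≅ L ⊗_K Γ(X, U)` (Mathlib
  `isIso_pushoutSection_of_isAffineOpen`), the sections of `(I.map pr)·𝒪` and of `I.map pr` are
  `Ideal.map`/`Ideal.comap` along `pr♯` (`ideal_comap_preimage_of_isAffineHom`,
  `ideal_map_of_isAffineHom`), and the ring-level statement applies to `𝔞 = I(pr⁻¹U)`, which is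
  stable under the semilinear action `σ ↦ (gal σ⁻¹)♯` because `I` is.
* `GaloisDescent.exists_eq_comap_fst_of_forall_comap_gal_eq` — the same as an existence statement.

Requested by the lead of crux `DescentAlgclosedToPerfect` (stmt-ResolutionOfSingularities-0550):
with `Summit.….Theorems.hasResolution_of_isBlowup_comap_fieldExtension` it gives Galois descent of
BLOW-UP resolutions (a Galois-invariant resolving ideal on `X_L` descends to a resolution of `X`).
Mathlib (pin) has `IdealSheafData.map/comap` and their Galois connection but no descent statement;
the tree had Galois descent of morphisms (`GaloisDescent.descentScheme`), of schemes
(`GaloisDescentScheme`) and of functions (`GaloisDescentFixedPoints`), not of ideals.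

## References

* U. Görtz, T. Wedhorn, *Algebraic Geometry I: Schemes*, 2nd ed. (2020), §(14.20)–(14.21),
  Thm. 14.83 (Galois descent for quasi-coherent modules and closed subschemes). [GortzWedhorn2020]
* J.-P. Serre, *Local Fields*, GTM 67 (1979), Ch. X, §2, Prop. 3 / Lemma 1. [SerreLocalFields1979]
-/

noncomputable section

open CategoryTheory CategoryTheory.Limits AlgebraicGeometry TopologicalSpace
open Literature.AlgebraicGeometry.Limits
open scoped TensorProduct

universe u

namespace Literature.AlgebraicGeometry.Motives

/-! ## Ring level: a Galois-stable ideal of `L ⊗_K C` is extended from `C` -/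

section Ring

open Literature.RingTheory.GaloisAlgebras

variable {K L C D : Type*} [Field K] [Field L] [Algebra K L] [FiniteDimensional K L] [IsGalois K L]
  [CommRing C] [Algebra K C] [CommRing D] [Algebra K D] [Algebra L D] [Algebra C D]
  [IsScalarTower K L D] [IsScalarTower K C D] [Algebra.IsPushout K L C D]

/-- **Galois descent of ideals (Speiser).** Let `D ≅ L ⊗_K C` (`Algebra.IsPushout K L C D`) for a
finite Galois extension `L/K`, and let `Gal(L/K)` act on `D` by ring endomorphisms `τ σ` fixing `C`
and inducing `σ` on `L` (so `τ σ` corresponds to `σ ⊗ 1`). An ideal `𝔞 ⊆ D` stable under all `τ σ`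
is extended from `C`: `(𝔞 ∩ C)·D = 𝔞`. The `L`-submodule `𝔞` with the restricted semilinear
action is spanned over `L` by its fixed vectors (Speiser), and fixed vectors of `D` come from `C`.
[cite: SerreLocalFields1979, Ch. X, §2, Prop. 3 and Lemma 1; GortzWedhorn2020, Thm. 14.83] -/
theorem Ideal.map_comap_eq_of_forall_map_le (τ : (L ≃ₐ[K] L) →* (D →+* D))
    (hC : ∀ σ c, τ σ (algebraMap C D c) = algebraMap C D c)
    (hL : ∀ σ l, τ σ (algebraMap L D l) = algebraMap L D (σ l))
    (𝔞 : Ideal D) (h𝔞 : ∀ σ, 𝔞.map (τ σ) ≤ 𝔞) :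
    (𝔞.comap (algebraMap C D)).map (algebraMap C D) = 𝔞 := by
  classical
  refine le_antisymm Ideal.map_comap_le fun d hd => ?_
  -- the `L`-submodule `𝔞` with its semilinear `Gal(L/K)`-action
  let V : Submodule L D := 𝔞.restrictScalars L
  have hτV : ∀ (σ : L ≃ₐ[K] L) (v : V), τ σ (v : D) ∈ V := fun σ v =>
    h𝔞 σ (Ideal.mem_map_of_mem _ v.2)
  let ρ₀ : (L ≃ₐ[K] L) → AddMonoid.End V := fun σ =>
    { toFun := fun v => ⟨τ σ v, hτV σ v⟩
      map_zero' := by ext; simp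
      map_add' := fun v w => by ext; simp }
  have hρ₀ : ∀ σ (v : V), ((ρ₀ σ v : V) : D) = τ σ v := fun _ _ => rfl
  let ρ : (L ≃ₐ[K] L) →* AddMonoid.End V :=
    { toFun := ρ₀
      map_one' := by
        ext v
        change ((ρ₀ 1 v : V) : D) = v
        rw [hρ₀, map_one]; rfl
      map_mul' := fun σ σ' => by
        ext v
        change ((ρ₀ (σ * σ') v : V) : D) = ((ρ₀ σ (ρ₀ σ' v) : V) : D)
        rw [hρ₀, hρ₀, hρ₀, map_mul]; rfl }
  have hρ : ∀ (s : L ≃ₐ[K] L) (e : L) (v : V), ρ s (e • v) = (s • e) • ρ s v := by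
    intro s e v
    ext
    change τ s ((e • v : V) : D) = (s • e) • τ s (v : D)
    rw [Submodule.coe_smul, Algebra.smul_def, Algebra.smul_def, map_mul, hL]
    rfl
  have hmem := mem_span_fixedPoints (Γ := L ≃ₐ[K] L) (E := L) (V := V) ρ hρ ⟨d, hd⟩
  -- every fixed vector lies in `(𝔞 ∩ C)·D`
  have hfix : ∀ w : V, (∀ s, ρ s w = w) →
      (w : D) ∈ (𝔞.comap (algebraMap C D)).map (algebraMap C D) := by
    intro w hw
    have hw' : ∀ σ, τ σ (w : D) = w := fun σ => congrArg (fun v : V => (v : D)) (hw σ)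
    obtain ⟨c, hc⟩ := mem_range_of_isPushout_of_forall_eq K L C τ hC hL (w : D) hw'
    rw [← hc]
    refine Ideal.mem_map_of_mem _ ?_
    rw [Ideal.mem_comap, hc]
    exact w.2
  -- and the `L`-span of such vectors stays inside that ideal
  have hspan : Submodule.span L {w : V | ∀ s, ρ s w = w} ≤
      (((𝔞.comap (algebraMap C D)).map (algebraMap C D)).restrictScalars L).comap V.subtype := by
    rw [Submodule.span_le]
    intro w hw
    exact hfix w hw
  simpa using hspan hmem

end Ring

/-! ## Scheme level: invariant ideal sheaves on `X_L` come from `X` -/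

namespace GaloisDescent

open AbelianVariety (bcSpec specAut)

set_option backward.isDefEq.respectTransparency false

variable {K : Type u} [Field K] (L : Type u) [Field L] [Algebra K L] (X : SchemeOver K)

/-- `(gal σ)⁻¹ (pr⁻¹ U) = pr⁻¹ U`: the Galois automorphisms act fibrewise over `X`. [folklore] -/
theorem gal_preimage_fst_preimage (σ : L ≃ₐ[K] L) (U : X.left.Opens) :
    gal L X σ ⁻¹ᵁ (pullback.fst X.hom (bcSpec K L) ⁻¹ᵁ U) =
      pullback.fst X.hom (bcSpec K L) ⁻¹ᵁ U := by
  rw [← Scheme.Hom.comp_preimage, gal_fst]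

/-- `gal σ` is an isomorphism (inverse `gal σ⁻¹`). [folklore] -/
instance isIso_gal (σ : L ≃ₐ[K] L) : IsIso (gal L X σ) :=
  ⟨gal L X σ⁻¹, gal_comp_gal_symm L X σ, gal_symm_comp_gal L X σ⟩

variable {L X} in
/-- `(𝟙 Y).appLE W W _ = 𝟙`. [folklore] -/
theorem id_appLE_self {Y : Scheme.{u}} (W : Y.Opens) (h : W ≤ (𝟙 Y) ⁻¹ᵁ W) :
    (𝟙 Y :).appLE W W h = 𝟙 _ := by
  rw [Scheme.Hom.appLE, Scheme.Hom.id_app, Category.id_comp]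
  have : (homOfLE h).op = 𝟙 (Opposite.op W) := Subsingleton.elim _ _
  rw [this]
  exact Y.presheaf.map_id _

variable {L X} in
/-- `g.appTop = g.appLE ⊤ ⊤ _`. [folklore] -/
theorem appTop_eq_appLE {Y Z : Scheme.{u}} (g : Y ⟶ Z) : g.appTop = g.appLE ⊤ ⊤ le_top := by
  rw [Scheme.Hom.appTop, Scheme.Hom.app_eq_appLE]
  rfl

/-- The Galois automorphism `σ` acting on the sections of `X_L` over the stable open `pr⁻¹U` by
`(gal σ⁻¹)♯` (the inverse makes the action a LEFT action, as in `GaloisDescentScheme.actTop`).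
[folklore] -/
def galSectionsFun (U : X.left.Opens) (σ : L ≃ₐ[K] L) :
    Γ(bc L X, pullback.fst X.hom (bcSpec K L) ⁻¹ᵁ U) →+*
      Γ(bc L X, pullback.fst X.hom (bcSpec K L) ⁻¹ᵁ U) :=
  ((gal L X σ⁻¹).appLE (pullback.fst X.hom (bcSpec K L) ⁻¹ᵁ U)
    (pullback.fst X.hom (bcSpec K L) ⁻¹ᵁ U) (gal_preimage_fst_preimage L X σ⁻¹ U).ge).hom

/-- Unfolding `galSectionsFun`. [folklore] -/
theorem galSectionsFun_apply (U : X.left.Opens) (σ : L ≃ₐ[K] L) :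
    galSectionsFun L X U σ = ((gal L X σ⁻¹).appLE (pullback.fst X.hom (bcSpec K L) ⁻¹ᵁ U)
      (pullback.fst X.hom (bcSpec K L) ⁻¹ᵁ U) (gal_preimage_fst_preimage L X σ⁻¹ U).ge).hom := rfl

/-- `galSectionsFun 1 = id`. [folklore] -/
theorem galSectionsFun_one (U : X.left.Opens) :
    galSectionsFun L X U 1 = RingHom.id _ := by
  have e : gal L X (1 : L ≃ₐ[K] L)⁻¹ = 𝟙 _ := by rw [inv_one, gal_one]
  have h' : pullback.fst X.hom (bcSpec K L) ⁻¹ᵁ U ≤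
      (𝟙 (bc L X)) ⁻¹ᵁ (pullback.fst X.hom (bcSpec K L) ⁻¹ᵁ U) := by
    rw [Scheme.Hom.id_preimage]
  rw [galSectionsFun_apply, SubalgApprox.appLE_congrHom e (pullback.fst X.hom (bcSpec K L) ⁻¹ᵁ U)
    (pullback.fst X.hom (bcSpec K L) ⁻¹ᵁ U) _ h', id_appLE_self, CommRingCat.hom_id]

/-- `galSectionsFun (σ σ') = galSectionsFun σ ∘ galSectionsFun σ'`. [folklore] -/
theorem galSectionsFun_mul (U : X.left.Opens) (σ σ' : L ≃ₐ[K] L) :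
    galSectionsFun L X U (σ * σ') = (galSectionsFun L X U σ).comp (galSectionsFun L X U σ') := by
  have e : gal L X σ⁻¹ ≫ gal L X σ'⁻¹ = gal L X (σ * σ')⁻¹ := by rw [mul_inv_rev, gal_mul]
  have key := SubalgApprox.appLE_comp_appLE_of_comp_eq (gal L X σ⁻¹) (gal L X σ'⁻¹)
    (gal L X (σ * σ')⁻¹) e
    (pullback.fst X.hom (bcSpec K L) ⁻¹ᵁ U) (pullback.fst X.hom (bcSpec K L) ⁻¹ᵁ U)
    (pullback.fst X.hom (bcSpec K L) ⁻¹ᵁ U) (gal_preimage_fst_preimage L X σ'⁻¹ U).ge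
    (gal_preimage_fst_preimage L X σ⁻¹ U).ge (gal_preimage_fst_preimage L X (σ * σ')⁻¹ U).ge
  exact congrArg CommRingCat.Hom.hom key.symm

/-- **The Galois action on the sections of `X_L` over `pr⁻¹U`**: `σ ↦ (gal σ⁻¹)♯` restricted to the
stable open `pr⁻¹U`, as a monoid homomorphism `Gal(L/K) →* End Γ(X_L, pr⁻¹U)`. [folklore] -/
def galSections (U : X.left.Opens) :
    (L ≃ₐ[K] L) →* (Γ(bc L X, pullback.fst X.hom (bcSpec K L) ⁻¹ᵁ U) →+*
      Γ(bc L X, pullback.fst X.hom (bcSpec K L) ⁻¹ᵁ U)) where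
  toFun := galSectionsFun L X U
  map_one' := galSectionsFun_one L X U
  map_mul' := galSectionsFun_mul L X U

/-- Unfolding `galSections`. [folklore] -/
theorem galSections_apply (U : X.left.Opens) (σ : L ≃ₐ[K] L) :
    galSections L X U σ = ((gal L X σ⁻¹).appLE (pullback.fst X.hom (bcSpec K L) ⁻¹ᵁ U)
      (pullback.fst X.hom (bcSpec K L) ⁻¹ᵁ U) (gal_preimage_fst_preimage L X σ⁻¹ U).ge).hom := rfl

/-- The action fixes the functions pulled back from `X`: `(gal σ⁻¹)♯ ∘ pr♯ = pr♯`. [folklore] -/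
theorem galSections_app_fst (U : X.left.Opens) (σ : L ≃ₐ[K] L) (c : Γ(X.left, U)) :
    galSections L X U σ ((pullback.fst X.hom (bcSpec K L)).app U c) =
      (pullback.fst X.hom (bcSpec K L)).app U c := by
  have hc := SubalgApprox.appLE_comp_appLE_of_comp_eq (gal L X σ⁻¹)
    (pullback.fst X.hom (bcSpec K L)) (pullback.fst X.hom (bcSpec K L)) (gal_fst L X σ⁻¹) U
    (pullback.fst X.hom (bcSpec K L) ⁻¹ᵁ U)
    (pullback.fst X.hom (bcSpec K L) ⁻¹ᵁ U) le_rfl (gal_preimage_fst_preimage L X σ⁻¹ U).ge le_rfl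
  rw [galSections_apply, Scheme.Hom.app_eq_appLE, ← CommRingCat.comp_apply, hc]

/-- The action induces `σ` on the scalars from `L`: `(gal σ⁻¹)♯ (pr₂♯ l) = pr₂♯ (σ l)`, where
`pr₂♯ : L = Γ(Spec L, ⊤) → Γ(X_L, pr⁻¹U)`. [folklore] -/
theorem galSections_app_snd (U : X.left.Opens) (σ : L ≃ₐ[K] L) (l : L) :
    galSections L X U σ ((pullback.snd X.hom (bcSpec K L)).appLE ⊤
        (pullback.fst X.hom (bcSpec K L) ⁻¹ᵁ U) le_top ((Scheme.ΓSpecIso (.of L)).inv l)) =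
      (pullback.snd X.hom (bcSpec K L)).appLE ⊤ (pullback.fst X.hom (bcSpec K L) ⁻¹ᵁ U) le_top
        ((Scheme.ΓSpecIso (.of L)).inv (σ l)) := by
  set W := pullback.fst X.hom (bcSpec K L) ⁻¹ᵁ U with hWdef
  have hW : W ≤ gal L X σ⁻¹ ⁻¹ᵁ W := (gal_preimage_fst_preimage L X σ⁻¹ U).ge
  have e : gal L X σ⁻¹ ≫ pullback.snd X.hom (bcSpec K L) =
      pullback.snd X.hom (bcSpec K L) ≫ specAut L σ := by rw [gal_snd, inv_inv]
  -- `pr₂♯ ≫ (gal σ⁻¹)♯ = (Spec σ)♯ ≫ pr₂♯` on the relevant opens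
  have key : (pullback.snd X.hom (bcSpec K L)).appLE ⊤ W le_top ≫ (gal L X σ⁻¹).appLE W W hW =
      (specAut L σ).appLE ⊤ ⊤ le_top ≫ (pullback.snd X.hom (bcSpec K L)).appLE ⊤ W le_top :=
    (SubalgApprox.appLE_comp_appLE_of_comp_eq (gal L X σ⁻¹) (pullback.snd X.hom (bcSpec K L)) _ e
      ⊤ W W le_top hW le_top).trans
    (SubalgApprox.appLE_comp_appLE_of_comp_eq (pullback.snd X.hom (bcSpec K L)) (specAut L σ) _
      rfl ⊤ ⊤ W le_top le_top le_top).symm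
  have hnat : (Scheme.ΓSpecIso (.of L)).inv ≫ (specAut L σ).appLE ⊤ ⊤ le_top =
      CommRingCat.ofHom (σ : L →+* L) ≫ (Scheme.ΓSpecIso (.of L)).inv := by
    rw [Scheme.ΓSpecIso_inv_naturality, appTop_eq_appLE]
  rw [galSections_apply, ← CommRingCat.comp_apply, key, CommRingCat.comp_apply,
    ← CommRingCat.comp_apply (Scheme.ΓSpecIso (.of L)).inv, hnat, CommRingCat.comp_apply]
  rfl

variable [FiniteDimensional K L] [IsGalois K L]

/-- **Galois descent of ideal sheaves.** For `L/K` finite Galois, a `K`-scheme `X` and an ideal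
sheaf `I` on `X_L = X ×_K Spec L` invariant under the Galois automorphisms
(`(gal σ)⁻¹ I·𝒪 = I` for all `σ`), the ideal sheaf `I.map pr` on `X` pulls back to `I`:
`(I.map pr)·𝒪_{X_L} = I`. Affine-locally over `X` this is `Ideal.map_comap_eq_of_forall_map_le`
for `Γ(X_L, pr⁻¹U) ≅ L ⊗_K Γ(X, U)`.
[cite: GortzWedhorn2020, Thm. 14.83 and §(14.21); SerreLocalFields1979, Ch. X, §2] -/
theorem comap_map_fst_eq_of_forall_comap_gal_eq (I : (bc L X).IdealSheafData)
    (hI : ∀ σ : L ≃ₐ[K] L, I.comap (gal L X σ) = I) :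
    (I.map (pullback.fst X.hom (bcSpec K L))).comap (pullback.fst X.hom (bcSpec K L)) = I := by
  classical
  set f := pullback.fst X.hom (bcSpec K L) with hf
  set q := pullback.snd X.hom (bcSpec K L) with hq
  haveI : IsAffineHom f := MorphismProperty.pullback_fst _ _ inferInstance
  -- compare on the affine opens `f⁻¹U`, `U ⊆ X` affine
  have hcov : ⨆ U : X.left.affineOpens, ((⟨f ⁻¹ᵁ U, U.2.preimage f⟩ : (bc L X).affineOpens) :
      (bc L X).Opens) = ⊤ := by
    change ⨆ U : X.left.affineOpens, f ⁻¹ᵁ (U : X.left.Opens) = ⊤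
    rw [← Scheme.Hom.preimage_iSup, iSup_affineOpens_eq_top, Scheme.Hom.preimage_top]
  refine Scheme.IdealSheafData.ext_of_iSup_eq_top _ hcov fun U => ?_
  rw [Literature.AlgebraicGeometry.Resolution.ideal_comap_preimage_of_isAffineHom,
    Scheme.IdealSheafData.ideal_map_of_isAffineHom]
  -- notation for the rings
  set W : (bc L X).affineOpens := ⟨f ⁻¹ᵁ U, U.2.preimage f⟩ with hW
  let C : Type u := Γ(X.left, U)
  let D : Type u := Γ(bc L X, f ⁻¹ᵁ U)
  -- algebra structures: `K → C` via `X → Spec K`, `L → D` via `pr₂`, `C → D` via `pr♯`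
  letI algKC : Algebra K C :=
    ((X.hom.appLE ⊤ U le_top).hom.comp (Scheme.ΓSpecIso (.of K)).inv.hom).toAlgebra
  letI algLD : Algebra L D :=
    ((q.appLE ⊤ (f ⁻¹ᵁ U) le_top).hom.comp (Scheme.ΓSpecIso (.of L)).inv.hom).toAlgebra
  letI algCD : Algebra C D := (f.app U).hom.toAlgebra
  letI algKD : Algebra K D := ((algebraMap L D).comp (algebraMap K L)).toAlgebra
  haveI : IsScalarTower K L D := IsScalarTower.of_algebraMap_eq fun _ => rfl
  -- the sections square is a pushout (Mathlib), hence `D ≅ L ⊗_K C`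
  have H : IsPullback f q X.hom (bcSpec K L) := IsPullback.of_hasPullback _ _
  have hUY : f ⁻¹ᵁ (U : X.left.Opens) = f ⁻¹ᵁ (U : X.left.Opens) ⊓ q ⁻¹ᵁ ⊤ := by simp
  have hsq := (isIso_pushoutSection_iff H (US := ⊤) (UT := ⊤) (UX := U) le_top le_top hUY).mp
    (isIso_pushoutSection_of_isAffineOpen H le_top le_top hUY (isAffineOpen_top _)
      (isAffineOpen_top _) U.2)
  -- hsq : IsPushout (X.hom.appLE ⊤ U _) ((bcSpec K L).appLE ⊤ ⊤ _) (f.appLE U (f⁻¹U) _)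
  --   (q.appLE ⊤ (f⁻¹U) _)
  have hKL : (bcSpec K L).appLE ⊤ ⊤ le_top ≫ (Scheme.ΓSpecIso (.of L)).hom =
      (Scheme.ΓSpecIso (.of K)).hom ≫ CommRingCat.ofHom (algebraMap K L) := by
    rw [← Scheme.ΓSpecIso_naturality, appTop_eq_appLE]
  have hsq' : IsPushout (CommRingCat.ofHom (algebraMap K L)) (CommRingCat.ofHom (algebraMap K C))
      (CommRingCat.ofHom (algebraMap L D)) (CommRingCat.ofHom (algebraMap C D)) := by
    refine hsq.flip.of_iso (Scheme.ΓSpecIso (.of K)) (Scheme.ΓSpecIso (.of L)) (Iso.refl _)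
      (Iso.refl _) hKL ?_ ?_ ?_
    · rw [Iso.refl_hom, Category.comp_id]
      change _ = (Scheme.ΓSpecIso (.of K)).hom ≫ ((Scheme.ΓSpecIso (.of K)).inv ≫
        X.hom.appLE ⊤ U le_top)
      rw [Iso.hom_inv_id_assoc]
    · rw [Iso.refl_hom, Category.comp_id]
      change _ = (Scheme.ΓSpecIso (.of L)).hom ≫ ((Scheme.ΓSpecIso (.of L)).inv ≫
        q.appLE ⊤ (f ⁻¹ᵁ U) le_top)
      rw [Iso.hom_inv_id_assoc]
    · rw [Iso.refl_hom, Iso.refl_hom, Category.comp_id, Category.id_comp,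
        ← Scheme.Hom.app_eq_appLE]
      rfl
  haveI : IsScalarTower K C D := by
    refine IsScalarTower.of_algebraMap_eq' ?_
    have w := congrArg (fun φ => φ.hom) hsq'.w
    simp only [CommRingCat.hom_comp, CommRingCat.hom_ofHom] at w
    -- `w : (algebraMap L D).comp (algebraMap K L) = (algebraMap C D).comp (algebraMap K C)`
    exact w
  haveI : Algebra.IsPushout K L C D := CommRingCat.isPushout_iff_isPushout.mp hsq'
  -- stability of `I(f⁻¹U)` under the Galois action on `D = Γ(X_L, f⁻¹U)`
  have hstab : ∀ σ : L ≃ₐ[K] L, (I.ideal W).map (galSections L X U σ) ≤ I.ideal W := by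
    intro σ
    rw [galSections_apply, Scheme.Hom.appLE, CommRingCat.hom_comp, ← Ideal.map_map]
    have h1 : (I.ideal W).map ((gal L X σ⁻¹).app (f ⁻¹ᵁ ↑U)).hom =
        I.ideal ⟨gal L X σ⁻¹ ⁻¹ᵁ (f ⁻¹ᵁ ↑U), W.2.preimage _⟩ := by
      rw [← Literature.AlgebraicGeometry.Resolution.ideal_comap_preimage_of_isAffineHom I
        (gal L X σ⁻¹) W, hI]
    rw [h1, Ideal.map_le_iff_le_comap]
    exact I.ideal_le_comap_ideal (U := W) (V := ⟨gal L X σ⁻¹ ⁻¹ᵁ (f ⁻¹ᵁ ↑U), W.2.preimage _⟩)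
      (gal_preimage_fst_preimage L X σ⁻¹ U).ge
  -- conclude by the ring-level statement
  exact Ideal.map_comap_eq_of_forall_map_le (K := K) (L := L) (C := C) (D := D)
    (galSections L X U) (fun σ c => galSections_app_fst L X U σ c)
    (fun σ l => galSections_app_snd L X U σ l) (I.ideal W) hstab

/-- **Galois descent of ideal sheaves, existence form**: a Galois-invariant ideal sheaf on `X_L` is
the pull-back `J·𝒪_{X_L}` of an ideal sheaf `J` on `X`. [cite: GortzWedhorn2020, Thm. 14.83] -/
theorem exists_eq_comap_fst_of_forall_comap_gal_eq (I : (bc L X).IdealSheafData)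
    (hI : ∀ σ : L ≃ₐ[K] L, I.comap (gal L X σ) = I) :
    ∃ J : X.left.IdealSheafData, J.comap (pullback.fst X.hom (bcSpec K L)) = I :=
  ⟨_, comap_map_fst_eq_of_forall_comap_gal_eq L X I hI⟩

end GaloisDescent

end Literature.AlgebraicGeometry.Motives

end
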